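import Literature.NumberTheory.DiophantineGeometry.MultiplicativeGroupApproximationProp434Proofs
import Literature.NumberTheory.DiophantineGeometry.MultiplicativeGroupApproximationProofs
import HarnessLib

/-!
# Evertse–Győry, Proposition 4.4.1 over `ℚ` (proved)

Topic `NumberTheory/DiophantineGeometry`; namespace
`Literature.NumberTheory.DiophantineGeometry.Dioph`.
Companion of `MultiplicativeGroupApproximation.lean` (the named fact
`evertseGyory_thm_4_2_1_rat`, Evertse–Győry Thm 4.2.1 for `K = ℚ`).

Evertse–Győry, *Unit Equations in Diophantine Number Theory* (2015), Proposition 4.4.1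
(pp. 80–81) is the geometry-of-numbers step of the proof of Theorem 4.2.1: a finitely generated
multiplicative group `Γ` has a system of generators modulo torsion with `∏ h(ξ'ᵢ) ≤ ∏ h(ξᵢ)`
in which every `ξ ∈ Γ` has exponents `≪ h(ξ)`. For `K = ℚ` this is PROVED here
(`exists_small_exponents`), with the constant `m^{2m} / log 2` (the book's `θ = 2/(d (log 3d)³)`
must be replaced by `θ = log 2` for `d = 1`, see the module docstring of
`MultiplicativeGroupApproximationProofs.lean`): the group `⟨±1, ξ₁, …, ξ_m⟩ ⊂ ℚ*` is mapped by
`y ↦ (ord_p y)_p` onto a lattice of integer vectors in `ℝ^P` on which the logarithmic height is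
the norm `heightSeminorm P` (`logHeight₁_eq_heightSeminorm_padicOrdVec`), Northcott's theorem
gives a height-minimal generating system (`exists_min_system`), and Proposition 4.3.4
(`exists_repr_le_of_minimal`, proved in `MultiplicativeGroupApproximationProp434Proofs.lean`
from Minkowski's second theorem, a Mahler-type basis, the Borosh–Flahive–Rubin–Treybig lemma
and Lemma 4.3.6) bounds the exponents.

## References

* [EvertseGyory2015] J.-H. Evertse, K. Győry, *Unit Equations in Diophantine Number Theory*,
  Cambridge Stud. Adv. Math. 146, CUP 2015 — Prop 4.4.1 and its proof (pp. 80–81).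
-/

open Height Real Finset Module

noncomputable section

namespace Literature.NumberTheory.DiophantineGeometry.Dioph

section MinimalSystem

variable {ι : Type}

/-- **Evertse–Győry, Proposition 4.4.1, for `K = ℚ`** (with the corrected constant), folded with
the choice of a height-minimal generating system made at the start of the proof of Theorem 4.2.1:
given non-torsion `ξ₁, …, ξ_m ∈ ℚ*` and `ξ = ζ ∏ ξᵢ^{bᵢ}` (`ζ = ±1`), there are non-torsion
`ξ'₁, …, ξ'_m` generating the same group modulo torsion, with `∏ h(ξ'ᵢ) ≤ ∏ h(ξᵢ)`, and a
representation `ξ = ζ' ∏ ξ'ᵢ^{b'ᵢ}` with `max |b'ᵢ| ≤ m^{2m} h(ξ) / log 2` (book: (4.4.16) with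
`c₁₆ (d/2)(log 3d)³` replaced by `q^{2q}/log 2 ≤ m^{2m}/log 2` for `d = 1`). Now PROVED:
Proposition 4.3.4 enters through `exists_repr_le_of_minimal`.
[cite: EvertseGyory2015, Prop 4.4.1 (pp. 80–81)] -/
theorem exists_small_exponents [Fintype ι] (hι : 0 < Fintype.card ι)
    (ξ : ι → ℚ) (hξ : ∀ i, ξ i ≠ 0 ∧ ξ i ≠ 1 ∧ ξ i ≠ -1) (ζ : ℚ) (hζ : ζ = 1 ∨ ζ = -1)
    (b : ι → ℤ) :
    ∃ (ξ' : ι → ℚ) (ζ' : ℚ) (b' : ι → ℤ), (∀ i, ξ' i ≠ 0 ∧ ξ' i ≠ 1 ∧ ξ' i ≠ -1) ∧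
      (ζ' = 1 ∨ ζ' = -1) ∧ ζ * ∏ i, ξ i ^ b i = ζ' * ∏ i, ξ' i ^ b' i ∧
      ∏ i, logHeight₁ (ξ' i) ≤ ∏ i, logHeight₁ (ξ i) ∧
      ∀ i, (|b' i| : ℝ) ≤ (Fintype.card ι : ℝ) ^ (2 * Fintype.card ι) *
        logHeight₁ (ζ * ∏ i, ξ i ^ b i) / Real.log 2 := by
  classical
  -- the set of primes
  set M : ℕ := ∑ i, ((ξ i).num.natAbs + (ξ i).den) + 1 with hM
  set P : Finset ℕ := Nat.primesBelow M with hPdef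
  have hP : ∀ p ∈ P, p.Prime := fun p hp => Nat.prime_of_mem_primesBelow hp
  have hξP : ∀ i, IsPUnit P (ξ i) := by
    intro i
    have hle : (ξ i).num.natAbs + (ξ i).den ≤ ∑ j, ((ξ j).num.natAbs + (ξ j).den) :=
      Finset.single_le_sum (f := fun j => (ξ j).num.natAbs + (ξ j).den) (fun _ _ => Nat.zero_le _)
        (Finset.mem_univ i)
    apply isPUnit_primesBelow (hξ i).1 <;> omega
  -- norm, generators, lattice
  set N : Seminorm ℝ (P → ℝ) := heightSeminorm P with hNdef
  have hN : ∀ z, N z = 0 → z = 0 := fun z hz => heightSeminorm_eq_zero hP hz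
  set a₀ : ι → (P → ℝ) := fun i => padicOrdVec P (ξ i) with ha₀
  set L : Submodule ℤ (P → ℝ) := Submodule.span ℤ (Set.range a₀) with hL
  have hLmem : ∀ z ∈ L, ∃ y, IsPUnit P y ∧ padicOrdVec P y = z := fun z hz =>
    exists_isPUnit_of_mem_span hP hξP hz
  have hθ : ∀ z ∈ L, z ≠ 0 → Real.log 2 ≤ N z := by
    intro z hz hz0
    obtain ⟨y, hy, rfl⟩ := hLmem z hz
    exact log_two_le_heightSeminorm_padicOrdVec hP hy hz0
  have ha₀ne : ∀ i, a₀ i ≠ 0 := by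
    intro i h0
    rcases eq_sign_of_padicOrdVec_eq_zero hP (hξP i) h0 with h | h
    · exact (hξ i).2.1 h
    · exact (hξ i).2.2 h
  have hNa₀ : ∀ i, N (a₀ i) = logHeight₁ (ξ i) := fun i =>
    (logHeight₁_eq_heightSeminorm_padicOrdVec hP (hξP i)).symm
  -- good systems; the minimal one
  let good : (ι → (P → ℝ)) → Prop := fun a' =>
    (∀ i, a' i ∈ L ∧ a' i ≠ 0) ∧ Submodule.span ℤ (Set.range a') = L
  have hgood₀ : good a₀ := ⟨fun i => ⟨Submodule.subset_span ⟨i, rfl⟩, ha₀ne i⟩, rfl⟩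
  have hgoodθ : ∀ a', good a' → ∀ i, Real.log 2 ≤ N (a' i) := fun a' ha' i =>
    hθ (a' i) (ha'.1 i).1 (ha'.1 i).2
  have hlog2 : 0 < Real.log 2 := Real.log_pos one_lt_two
  set R : ℝ := (∏ i, N (a₀ i)) * 2 ^ Fintype.card ι + ∑ i, N (a₀ i) with hRdef
  have hF₀ : 0 ≤ ∏ i, N (a₀ i) := Finset.prod_nonneg fun i _ => apply_nonneg N _
  have hR₀ : ∀ i, N (a₀ i) ≤ R := by
    intro i
    have h1 : N (a₀ i) ≤ ∑ j, N (a₀ j) :=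
      Finset.single_le_sum (f := fun j => N (a₀ j)) (fun j _ => apply_nonneg N _)
        (Finset.mem_univ i)
    have h2 : 0 ≤ (∏ i, N (a₀ i)) * 2 ^ Fintype.card ι := by positivity
    linarith
  have hRbig : ∀ a', good a' → (∃ i, R < N (a' i)) → ∏ i, N (a₀ i) ≤ ∏ i, N (a' i) := by
    rintro a' ha' ⟨j, hj⟩
    have hsplit : ∏ i, N (a' i) = N (a' j) * ∏ i ∈ Finset.univ.erase j, N (a' i) :=
      (Finset.mul_prod_erase Finset.univ (fun i => N (a' i)) (Finset.mem_univ j)).symm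
    have hrest : Real.log 2 ^ (Fintype.card ι - 1) ≤ ∏ i ∈ Finset.univ.erase j, N (a' i) := by
      have : ∏ _i ∈ Finset.univ.erase j, Real.log 2 = Real.log 2 ^ (Fintype.card ι - 1) := by
        rw [Finset.prod_const, Finset.card_erase_of_mem (Finset.mem_univ j), Finset.card_univ]
      rw [← this]
      exact Finset.prod_le_prod (fun i _ => hlog2.le) fun i _ => hgoodθ a' ha' i
    have hpow : (1 : ℝ) ≤ 2 ^ Fintype.card ι * Real.log 2 ^ (Fintype.card ι - 1) := by
      have hm : Fintype.card ι = (Fintype.card ι - 1) + 1 := (Nat.succ_pred_eq_of_pos hι).symm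
      have h22 : (1 : ℝ) ≤ 2 * Real.log 2 := by
        have := Real.log_two_gt_d9; linarith
      have h1 := one_le_pow₀ (n := Fintype.card ι - 1) h22
      calc (1 : ℝ) ≤ (2 * Real.log 2) ^ (Fintype.card ι - 1) * 2 := by linarith
        _ = 2 ^ (Fintype.card ι - 1 + 1) * Real.log 2 ^ (Fintype.card ι - 1) := by
            rw [mul_pow, pow_succ]; ring
        _ = 2 ^ Fintype.card ι * Real.log 2 ^ (Fintype.card ι - 1) := by rw [← hm]
    calc ∏ i, N (a₀ i)
        ≤ (∏ i, N (a₀ i)) * (2 ^ Fintype.card ι * Real.log 2 ^ (Fintype.card ι - 1)) :=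
          le_mul_of_one_le_right hF₀ hpow
      _ = ((∏ i, N (a₀ i)) * 2 ^ Fintype.card ι) * Real.log 2 ^ (Fintype.card ι - 1) := by ring
      _ ≤ R * Real.log 2 ^ (Fintype.card ι - 1) := by
          apply mul_le_mul_of_nonneg_right _ (by positivity)
          have : 0 ≤ ∑ i, N (a₀ i) := Finset.sum_nonneg fun i _ => apply_nonneg N _
          linarith
      _ ≤ N (a' j) * ∏ i ∈ Finset.univ.erase j, N (a' i) := by
          apply mul_le_mul hj.le hrest (by positivity) (apply_nonneg N _)
      _ = ∏ i, N (a' i) := hsplit.symm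
  set S : Set (P → ℝ) := padicOrdVec P '' {y : ℚ | logHeight₁ y ≤ R} with hSdef
  have hSfin : S.Finite := (NumberField.finite_setOf_logHeight₁_le ℚ R).image _
  have hmemS : ∀ a', good a' → ∀ i, N (a' i) ≤ R → a' i ∈ S := by
    intro a' ha' i hi
    obtain ⟨y, hy, hyeq⟩ := hLmem (a' i) (ha'.1 i).1
    refine ⟨y, ?_, hyeq⟩
    show logHeight₁ y ≤ R
    rwa [logHeight₁_eq_heightSeminorm_padicOrdVec hP hy, hyeq]
  obtain ⟨aS, haSgood, haSmin⟩ :=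
    exists_min_system N good a₀ hgood₀ R hR₀ hRbig S hSfin hmemS
  -- the element x
  set x : ℚ := ζ * ∏ i, ξ i ^ b i with hx
  have hprodP : IsPUnit P (∏ i, ξ i ^ b i) := IsPUnit.prod _ fun i _ => (hξP i).zpow (b i)
  have hxP : IsPUnit P x := (isPUnit_of_sign hζ).mul hprodP
  have hordx : padicOrdVec P x = ∑ i, b i • a₀ i := by
    rw [hx, padicOrdVec_mul hP (isPUnit_of_sign (P := P) hζ).1 hprodP.1, padicOrdVec_sign hζ,
      zero_add,
      padicOrdVec_prod_zpow hP (fun i => (hξ i).1)]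
  have hxL : padicOrdVec P x ∈ L := by
    rw [hordx]
    exact Submodule.sum_mem _ fun i _ => Submodule.smul_mem _ _ (Submodule.subset_span ⟨i, rfl⟩)
  -- Proposition 4.3.4 for the minimal system
  have haSint : ∀ i (p : P), ∃ n : ℤ, aS i p = n := by
    intro i p
    obtain ⟨y, -, hyeq⟩ := hLmem (aS i) (haSgood.1 i).1
    exact ⟨padicValRat p y, by rw [← hyeq]; rfl⟩
  have hθ' : ∀ w ∈ Submodule.span ℤ (Set.range aS), w ≠ 0 → Real.log 2 ≤ N w := by
    rw [haSgood.2]; exact hθ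
  have hmin' : ∀ a' : ι → P → ℝ, (∀ i, a' i ∈ Submodule.span ℤ (Set.range aS) ∧ a' i ≠ 0) →
      Submodule.span ℤ (Set.range a') = Submodule.span ℤ (Set.range aS) →
      ∏ i, N (aS i) ≤ ∏ i, N (a' i) := by
    intro a' ha' hsp
    rw [haSgood.2] at ha' hsp
    exact haSmin a' ⟨ha', hsp⟩
  have hxL' : padicOrdVec P x ∈ Submodule.span ℤ (Set.range aS) := by rw [haSgood.2]; exact hxL
  obtain ⟨b', hb'eq, hb'le⟩ := exists_repr_le_of_minimal N hN (Real.log 2) hlog2 aS haSint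
    (fun i => (haSgood.1 i).2) hθ' hmin' (padicOrdVec P x) hxL'
  -- lift the minimal system to P-units
  choose ξ' hξ'P hξ'eq using fun i => hLmem (aS i) (haSgood.1 i).1
  have hξ'nt : ∀ i, ξ' i ≠ 0 ∧ ξ' i ≠ 1 ∧ ξ' i ≠ -1 := by
    intro i
    refine ⟨(hξ'P i).1, ?_, ?_⟩
    · intro h; apply (haSgood.1 i).2; rw [← hξ'eq i, h, padicOrdVec_one]
    · intro h; apply (haSgood.1 i).2; rw [← hξ'eq i, h, padicOrdVec_neg, padicOrdVec_one]
  set w : ℚ := ∏ i, ξ' i ^ b' i with hw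
  have hwP : IsPUnit P w := IsPUnit.prod _ fun i _ => (hξ'P i).zpow (b' i)
  have hordw : padicOrdVec P w = padicOrdVec P x := by
    rw [hw, padicOrdVec_prod_zpow hP (fun i => (hξ'P i).1), hb'eq]
    apply Finset.sum_congr rfl; intro i _; rw [hξ'eq i]
  have hquot : x / w = 1 ∨ x / w = -1 := by
    apply eq_sign_of_padicOrdVec_eq_zero hP (hxP.mul hwP.inv)
    rw [padicOrdVec_mul hP hxP.1 hwP.inv.1, padicOrdVec_inv hP, hordw, add_neg_cancel]
  refine ⟨ξ', x / w, b', hξ'nt, hquot, ?_, ?_, ?_⟩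
  · rw [div_mul_cancel₀ x hwP.1]
  · -- Θ' ≤ Θ
    have h1 := haSmin a₀ hgood₀
    have e1 : ∏ i, logHeight₁ (ξ' i) = ∏ i, N (aS i) := by
      apply Finset.prod_congr rfl; intro i _
      rw [logHeight₁_eq_heightSeminorm_padicOrdVec hP (hξ'P i), hξ'eq i]
    have e2 : ∏ i, logHeight₁ (ξ i) = ∏ i, N (a₀ i) := by
      apply Finset.prod_congr rfl; intro i _; rw [hNa₀ i]
    rw [e1, e2]; exact h1
  · intro i
    have hi := hb'le i
    have hNx : N (padicOrdVec P x) = logHeight₁ x :=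
      (logHeight₁_eq_heightSeminorm_padicOrdVec hP hxP).symm
    rwa [hNx] at hi

end MinimalSystem

end Literature.NumberTheory.DiophantineGeometry.Dioph

end
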